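import Mathlib
import Literature.MathematicalPhysics.QuantumLattice.WilsonDiracAP
import Literature.MathematicalPhysics.QuantumLattice.SymbolCertificate
import Summits.QuantumFields.QCD.Theorems.QuarksAsStableActionCriticalLineDiamagnetismStubBlockHessianFormulaAuxB
import Summits.QuantumFields.QCD.Theorems.WilsonQuarkChessboardFlatCellOptimalStubBlockHessianFormulaAuxAllN

/-!
# Momentum blocks of the hopping perturbation, Parseval, and the colour ⊗ spin traces, `N` colours
(helper for crux stmt-QuantumFields-9307 `FlatCellOptimal`, line `registered`, stub
`stub_hessianMarginAllN`, sub-goal `stub_blockHessianFormulaAuxBAllN` — the `Fin 3 ↦ Fin N` port of the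
sibling crux stmt-QuantumFields-9734's `…CriticalLineDiamagnetismStubBlockHessianFormulaAuxB`, gap G2a,
wave 5)

What.  On the `2⁴` block `(ℤ/2)⁴` (colour `Fin N`, ANY `N : ℕ`, spin `Fin 4`) with constant central link
phases `u_μ = e^{iθ_μ}·1 ∈ U(N)`, the hopping perturbation `Δ(E)` (forward hop `(1 − γ_μ) ⊗ u_μ E(x,μ)`,
backward hop `(1 + γ_μ) ⊗ (u_μ E(y,μ))ᴴ`) of a matrix-valued link field `E : Edge 4 2 → M_N(ℂ)` has the
momentum blocks
`Δ̂(E)(k,k') = Σ_ν [ −½ e^{iP_{k'}ν} Ê_ν(k+k') ⊗ (1 − γ_ν) − ½ e^{−iP_k ν} Ê_ν(k+k')ᴴ ⊗ (1 + γ_ν) ]`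
in the real plane-wave basis `χ_s(x) = (−1)^{s·x}` (`Ê_ν(t) = Σ_x χ_t(x) E(x,ν)` the Walsh transform,
`P_k = θ + πk` the block momenta): `BlockHessianFormula.hat_hop`, `stub_blockHessianFormulaAuxBAllN` (the
sibling's `stub_blockHessianFormulaAuxB` is the case `N = 3`; the statement is the sibling's with
`Fin 3 ↦ Fin N` and with the `let`s `Dl, mom, chi, Yh, hat` turned into universally quantified variables
with defining equations, so that the registered signature contains no `:=`).  Also, for `N` colours:
Parseval `Σ_s Ê_μ(s)ᴴ Ê_μ(s) = 16 Σ_x E(x,μ)ᴴ E(x,μ)` (`parseval`) and the colour ⊗ spin trace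
factorisations `trace_kron_one/two`, `kron_smul_add` of the assembly.  The colour-free pieces of the
sibling file (character orthogonality `sum_torusChar_mul_two`, the tadpole spin trace
`trace_symbolInv_mul_hop`, `trace_symbolAdj_mul`, the Walsh re-indexing `sum_reindex`,
`exp_add_nat_mul_two_pi`, the real-part bookkeeping `re_bubble_bookkeeping`, `re_tadpole_bookkeeping`)
are re-EXPORTED here under the same names (aliases, no restatement).

How.  Entrywise evaluation of the Kronecker-delta hops against the characters
(`χ_{k'}(y + e_ν) = χ_{k'}(y) χ_{k'}(e_ν)`, `χ_k χ_{k'} = χ_{k+k'}` — `LaurentSymbol.torusChar_add_left` —,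
`e^{iθ_ν} χ_k(e_ν) = e^{iP_k ν}`), character orthogonality `Σ_s χ_s(x) χ_s(x') = 16 δ_{xx'}`, and
`tr (A ⊗ B) = tr A · tr B`; the colour matrices are carried along untouched, so the proofs are the
sibling's verbatim with `Fin 3 ↦ Fin N`.

References: Montvay–Münster, *Quantum Fields on a Lattice* §4.2 (Wilson fermions, hopping expansion in
momentum space); folklore.  Pure theorem file (no `def`s).
-/

noncomputable section

open scoped BigOperators Classical Matrix ComplexConjugate
open Finset
open Literature.MathematicalPhysics.QuantumLattice Literature.MathematicalPhysics.QuantumFieldTheory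
  Literature.Probability.LatticeModels

namespace Summit.QuantumFields.QCD.Cruxes.FlatCellOptimal.BlockHessian

open scoped Kronecker
open Complex (I)
open Summit.QuantumFields.QCD.Cruxes.WilsonQuarkStability.FreeTangentLandauChessboard
  (exp_mul_torusChar_single exp_neg_mul_conj_torusChar_single)

namespace BlockHessianFormula

/-! ### The colour-free lemmas of the sibling file, re-exported under the same names (aliases) -/

export Summit.QuantumFields.QCD.Cruxes.CriticalLineDiamagnetism.ChessboardCellGain.BlockHessianFormula
  (sum_torusChar_mul_two trace_symbolAdj_mul trace_symbolInv_mul_hop sum_reindex exp_add_nat_mul_two_pi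
    re_bubble_bookkeeping re_tadpole_bookkeeping)

/-! ### Parseval for the Walsh transform of an `N × N`-matrix-valued link field -/

/-- **Parseval** (`N` colours): `Σ_s Ê_μ(s)ᴴ Ê_μ(s) = 16 Σ_x E(x,μ)ᴴ E(x,μ)` for the Walsh transform
`Ê_μ(s) = Σ_x χ_s(x) E(x,μ)` with the real signs `χ_s(x) = (−1)^{s·x}`. -/
theorem parseval {N : ℕ} (chi : (Fin 4 → ZMod 2) → TorusSite 4 2 → ℝ)
    (Yh : (Edge 4 2 → Matrix (Fin N) (Fin N) ℂ) → (Fin 4 → ZMod 2) → Fin 4 → Matrix (Fin N) (Fin N) ℂ)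
    (hchi : ∀ s x, chi s x = (-1 : ℝ) ^ (∑ κ, (s κ).val * (x κ).val))
    (hYh : ∀ E s μ, Yh E s μ = ∑ x, ((chi s x : ℝ) : ℂ) • E (x, μ))
    (E : Edge 4 2 → Matrix (Fin N) (Fin N) ℂ) (μ : Fin 4) :
    ∑ s, (Yh E s μ)ᴴ * Yh E s μ = (16 : ℂ) • ∑ x, (E (x, μ))ᴴ * E (x, μ) := by
  -- adapted from the sibling's `BlockHessianFormula.parseval` (`Fin 3 ↦ Fin N`)
  have hct : ∀ s x, ((chi s x : ℝ) : ℂ) = torusChar s x := fun s x => by rw [torusChar_two, hchi]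
  have hH : ∀ s, (Yh E s μ)ᴴ = ∑ x, ((chi s x : ℝ) : ℂ) • (E (x, μ))ᴴ := fun s => by
    rw [hYh, Matrix.conjTranspose_sum]
    simp only [Matrix.conjTranspose_smul, Complex.star_def, Complex.conj_ofReal]
  simp_rw [hH, hYh, hct, Matrix.sum_mul, Matrix.mul_sum, Matrix.smul_mul, Matrix.mul_smul, smul_smul]
  rw [Finset.sum_comm]
  refine (Finset.sum_congr rfl fun x _ => Finset.sum_comm).trans ?_
  simp_rw [← Finset.sum_smul, sum_torusChar_mul_two, ite_smul, zero_smul, Finset.sum_ite_eq,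
    Finset.mem_univ, if_true, Finset.smul_sum]

/-! ### Momentum blocks of the hopping perturbation, `N` colours -/

section Hop

variable {N : ℕ} (θ : Fin 4 → ℝ) (u : Fin 4 → Matrix.unitaryGroup (Fin N) ℂ)
  (Dl : (Edge 4 2 → Matrix (Fin N) (Fin N) ℂ) →
    Matrix (TorusSite 4 2 × Fin N × Fin 4) (TorusSite 4 2 × Fin N × Fin 4) ℂ)
  (mom : (Fin 4 → ZMod 2) → Fin 4 → ℝ) (chi : (Fin 4 → ZMod 2) → TorusSite 4 2 → ℝ)
  (Yh : (Edge 4 2 → Matrix (Fin N) (Fin N) ℂ) → (Fin 4 → ZMod 2) → Fin 4 → Matrix (Fin N) (Fin N) ℂ)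
  (hat : Matrix (TorusSite 4 2 × Fin N × Fin 4) (TorusSite 4 2 × Fin N × Fin 4) ℂ →
    (Fin 4 → ZMod 2) → (Fin 4 → ZMod 2) → Matrix (Fin N × Fin 4) (Fin N × Fin 4) ℂ)

/-- **Momentum blocks of the hopping perturbation** `Δ(E)` in the real plane-wave basis (`N` colours):
`Δ̂(E)(k,k') = Σ_ν [ −½ e^{iP_{k'}ν} Ê_ν(k+k') ⊗ (1 − γ_ν) − ½ e^{−iP_k ν} Ê_ν(k+k')ᴴ ⊗ (1 + γ_ν) ]`
(the forward hop carries the plane wave `χ_{k'}` across the link and picks up `e^{iθ_ν} χ_{k'}(e_ν) = e^{iP_{k'}ν}`,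
the backward hop picks up `e^{−iθ_ν} χ_k(e_ν) = e^{−iP_k ν}`; the product `χ_k χ_{k'} = χ_{k+k'}` is the
Walsh momentum transfer). -/
theorem hat_hop
    (hu : ∀ μ, (u μ : Matrix (Fin N) (Fin N) ℂ) = Complex.exp (↑(θ μ) * I) • (1 : Matrix (Fin N) (Fin N) ℂ))
    (hDl : ∀ E, Dl E = Matrix.of fun p q : TorusSite 4 2 × Fin N × Fin 4 => -(1 / 2 : ℂ) * ∑ μ : Fin 4,
      ((if q.1 = Site.shift p.1 μ then ((1 : Matrix (Fin 4) (Fin 4) ℂ) - euclideanGamma μ) p.2.2 q.2.2 *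
          ((u μ : Matrix (Fin N) (Fin N) ℂ) * E (p.1, μ)) p.2.1 q.2.1 else 0) +
        (if p.1 = Site.shift q.1 μ then ((1 : Matrix (Fin 4) (Fin 4) ℂ) + euclideanGamma μ) p.2.2 q.2.2 *
          ((u μ : Matrix (Fin N) (Fin N) ℂ) * E (q.1, μ))ᴴ p.2.1 q.2.1 else 0)))
    (hmom : ∀ s κ, mom s κ = θ κ + Real.pi * ((s κ).val : ℝ))
    (hchi : ∀ s x, chi s x = (-1 : ℝ) ^ (∑ κ, (s κ).val * (x κ).val))
    (hYh : ∀ E s μ, Yh E s μ = ∑ x, ((chi s x : ℝ) : ℂ) • E (x, μ))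
    (hhat : ∀ A k k', hat A k k' =
      ∑ y, ∑ z, ((chi k y * chi k' z : ℝ) : ℂ) • Matrix.of fun c c' : Fin N × Fin 4 => A (y, c) (z, c'))
    (E : Edge 4 2 → Matrix (Fin N) (Fin N) ℂ) (k k' : Fin 4 → ZMod 2) :
    hat (Dl E) k k' = ∑ ν, ((-(1 / 2 : ℂ) * Complex.exp (↑(mom k' ν) * I)) •
        (Yh E (k + k') ν ⊗ₖ ((1 : Matrix (Fin 4) (Fin 4) ℂ) - euclideanGamma ν)) +
      (-(1 / 2 : ℂ) * Complex.exp (-(↑(mom k ν) * I))) •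
        ((Yh E (k + k') ν)ᴴ ⊗ₖ ((1 : Matrix (Fin 4) (Fin 4) ℂ) + euclideanGamma ν))) := by
  -- adapted from the sibling's `BlockHessianFormula.hat_hop` (`Fin 3 ↦ Fin N`)
  have hct : ∀ s x, ((chi s x : ℝ) : ℂ) = torusChar s x := fun s x => by rw [torusChar_two, hchi]
  have hθ' : ∀ v t : ℝ, 2 * Real.pi * v / ((2 : ℕ) : ℝ) + t = t + Real.pi * v := fun v t => by
    push_cast; ring
  have hreal : ∀ (s : Fin 4 → ZMod 2) (x : TorusSite 4 2), conj (torusChar s x) = torusChar s x :=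
    fun s x => by rw [← hct, Complex.conj_ofReal]
  -- the phases picked up by a hop
  have hfw : ∀ (s : Fin 4 → ZMod 2) (ν : Fin 4),
      Complex.exp (↑(θ ν) * I) * torusChar s (Pi.single ν 1) = Complex.exp (↑(mom s ν) * I) := by
    intro s ν
    rw [exp_mul_torusChar_single, hθ', hmom, Complex.exp_mul_I, ← Complex.ofReal_cos,
      ← Complex.ofReal_sin]
  have hbw : ∀ (s : Fin 4 → ZMod 2) (ν : Fin 4),
      star (Complex.exp (↑(θ ν) * I)) * torusChar s (Pi.single ν 1) =
        Complex.exp (-(↑(mom s ν) * I)) := by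
    intro s ν
    rw [← hreal, Complex.star_def, ← Complex.exp_conj, map_mul, Complex.conj_ofReal, Complex.conj_I,
      mul_neg, exp_neg_mul_conj_torusChar_single, hθ', hmom, Complex.ofReal_cos, Complex.ofReal_sin,
      Complex.cos_sub_sin_I, neg_mul]
  -- colour factors
  have hu' : ∀ ν x, (u ν : Matrix (Fin N) (Fin N) ℂ) * E (x, ν) = Complex.exp (↑(θ ν) * I) • E (x, ν) :=
    fun ν x => by rw [hu, Matrix.smul_mul, Matrix.one_mul]
  have hYhH : ∀ s ν, (Yh E s ν)ᴴ = ∑ x, ((chi s x : ℝ) : ℂ) • (E (x, ν))ᴴ := fun s ν => by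
    rw [hYh, Matrix.conjTranspose_sum]
    simp only [Matrix.conjTranspose_smul, Complex.star_def, Complex.conj_ofReal]
  have hadd : ∀ (M₁ M₂ : Matrix (Fin N × Fin 4) (Fin N × Fin 4) ℂ) (i j : Fin N × Fin 4),
      (M₁ + M₂) i j = M₁ i j + M₂ i j := fun _ _ _ _ => rfl
  ext ⟨b, β⟩ ⟨c, γ⟩
  -- forward hops, summed against the characters
  have hF : ∑ y : TorusSite 4 2, ∑ z : TorusSite 4 2, ∑ ν : Fin 4, torusChar k y * torusChar k' z *
      (-(1 / 2 : ℂ) * (if z = Site.shift y ν then ((1 : Matrix (Fin 4) (Fin 4) ℂ) - euclideanGamma ν) β γ *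
        (Complex.exp (↑(θ ν) * I) * E (y, ν) b c) else 0)) =
      ∑ ν : Fin 4, -(1 / 2 : ℂ) * Complex.exp (↑(mom k' ν) * I) *
        ((∑ y, torusChar (k + k') y * E (y, ν) b c) *
          ((1 : Matrix (Fin 4) (Fin 4) ℂ) - euclideanGamma ν) β γ) := by
    refine (Finset.sum_congr rfl fun y _ => Finset.sum_comm).trans ?_
    rw [Finset.sum_comm]
    refine Finset.sum_congr rfl fun ν _ => ?_
    simp_rw [mul_ite, mul_zero, Finset.sum_ite_eq', Finset.mem_univ, if_true]
    rw [Finset.sum_mul, Finset.mul_sum]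
    refine Finset.sum_congr rfl fun y _ => ?_
    rw [Literature.MathematicalPhysics.QuantumFieldTheory.Site.shift, torusChar_add_right,
      LaurentSymbol.torusChar_add_left, ← hfw k' ν]
    ring
  -- backward hops, summed against the characters
  have hB : ∑ y : TorusSite 4 2, ∑ z : TorusSite 4 2, ∑ ν : Fin 4, torusChar k y * torusChar k' z *
      (-(1 / 2 : ℂ) * (if y = Site.shift z ν then ((1 : Matrix (Fin 4) (Fin 4) ℂ) + euclideanGamma ν) β γ *
        (star (Complex.exp (↑(θ ν) * I)) * (E (z, ν))ᴴ b c) else 0)) =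
      ∑ ν : Fin 4, -(1 / 2 : ℂ) * Complex.exp (-(↑(mom k ν) * I)) *
        ((∑ z, torusChar (k + k') z * (E (z, ν))ᴴ b c) *
          ((1 : Matrix (Fin 4) (Fin 4) ℂ) + euclideanGamma ν) β γ) := by
    rw [Finset.sum_comm]
    refine (Finset.sum_congr rfl fun z _ => Finset.sum_comm).trans ?_
    rw [Finset.sum_comm]
    refine Finset.sum_congr rfl fun ν _ => ?_
    simp_rw [mul_ite, mul_zero, Finset.sum_ite_eq', Finset.mem_univ, if_true]
    rw [Finset.sum_mul, Finset.mul_sum]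
    refine Finset.sum_congr rfl fun z _ => ?_
    rw [Literature.MathematicalPhysics.QuantumFieldTheory.Site.shift, torusChar_add_right,
      LaurentSymbol.torusChar_add_left, ← hbw k ν]
    ring
  rw [hhat]
  simp only [hYhH]
  simp only [Matrix.sum_apply, Matrix.smul_apply, Matrix.of_apply, hadd, hDl, hu',
    Matrix.kronecker_apply, smul_eq_mul, Complex.ofReal_mul, hct, hYh, Matrix.conjTranspose_smul]
  simp only [Finset.mul_sum, mul_add, Finset.sum_add_distrib]
  rw [hF, hB]

end Hop

/-! ### Colour ⊗ spin traces for the assembly of the block Hessian, `N` colours -/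

/-- Colour ⊗ spin traces: `tr ((1 ⊗ S)(Σ_ν A_ν ⊗ V_ν)(1 ⊗ S')(Σ_μ B_μ ⊗ W_μ)) = Σ_μ Σ_ν tr (A_ν B_μ) tr (S V_ν S' W_μ)`. -/
theorem trace_kron_two {N : ℕ} (S₁ S₂ : Matrix (Fin 4) (Fin 4) ℂ) (A B : Fin 4 → Matrix (Fin N) (Fin N) ℂ)
    (V W : Fin 4 → Matrix (Fin 4) (Fin 4) ℂ) :
    ((1 : Matrix (Fin N) (Fin N) ℂ) ⊗ₖ S₁ * (∑ ν, A ν ⊗ₖ V ν) *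
        ((1 : Matrix (Fin N) (Fin N) ℂ) ⊗ₖ S₂ * ∑ μ, B μ ⊗ₖ W μ)).trace =
      ∑ μ, ∑ ν, (A ν * B μ).trace * (S₁ * V ν * (S₂ * W μ)).trace := by
  simp only [Matrix.mul_sum, Matrix.sum_mul, Matrix.trace_sum, ← Matrix.mul_kronecker_mul,
    Matrix.one_mul, Matrix.trace_kronecker]

/-- Colour ⊗ spin traces: `tr ((1 ⊗ S)(Σ_ν A_ν ⊗ V_ν)) = Σ_ν tr A_ν · tr (S V_ν)`. -/
theorem trace_kron_one {N : ℕ} (S₁ : Matrix (Fin 4) (Fin 4) ℂ) (A : Fin 4 → Matrix (Fin N) (Fin N) ℂ)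
    (V : Fin 4 → Matrix (Fin 4) (Fin 4) ℂ) :
    ((1 : Matrix (Fin N) (Fin N) ℂ) ⊗ₖ S₁ * ∑ ν, A ν ⊗ₖ V ν).trace = ∑ ν, (A ν).trace * (S₁ * V ν).trace := by
  simp only [Matrix.mul_sum, Matrix.trace_sum, ← Matrix.mul_kronecker_mul, Matrix.one_mul,
    Matrix.trace_kronecker]

/-- `A ⊗ (aG + cG') = a (A ⊗ G) + c (A ⊗ G')`. -/
theorem kron_smul_add {N : ℕ} (A : Matrix (Fin N) (Fin N) ℂ) (a c : ℂ) (G G' : Matrix (Fin 4) (Fin 4) ℂ) :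
    A ⊗ₖ (a • G + c • G') = a • (A ⊗ₖ G) + c • (A ⊗ₖ G') := by
  rw [Matrix.kronecker_add, Matrix.kronecker_smul, Matrix.kronecker_smul]

end BlockHessianFormula

open BlockHessianFormula in
/-- **Sub-goal `stub_blockHessianFormulaAuxBAllN`** (momentum blocks of the hopping perturbation, `N`
colours): on the `2⁴` block with constant central phases `u_μ = e^{iθ_μ}·1 ∈ U(N)`, for every matrix-valued
link field `E` and block momenta `k, k'`,
`Δ̂(E)(k,k') = Σ_ν [ −½ e^{iP_{k'}ν} Ê_ν(k+k') ⊗ (1 − γ_ν) − ½ e^{−iP_k ν} Ê_ν(k+k')ᴴ ⊗ (1 + γ_ν) ]`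
(`Ê_ν(t) = Σ_x χ_t(x) E(x,ν)`, `χ_s(x) = (−1)^{s·x}`, `P_k = θ + πk`; `Dl, mom, chi, Yh, hat` given by their
defining equations). -/
theorem stub_blockHessianFormulaAuxBAllN : ∀ (N : ℕ) (θ : Fin 4 → ℝ) (u : Fin 4 → Matrix.unitaryGroup (Fin N) ℂ), (∀ μ, ((u μ : Matrix.unitaryGroup (Fin N) ℂ) : Matrix (Fin N) (Fin N) ℂ) = Complex.exp (↑(θ μ) * Complex.I) • (1 : Matrix (Fin N) (Fin N) ℂ)) → ∀ (Dl : (Edge 4 2 → Matrix (Fin N) (Fin N) ℂ) → Matrix (TorusSite 4 2 × Fin N × Fin 4) (TorusSite 4 2 × Fin N × Fin 4) ℂ) (mom : (Fin 4 → ZMod 2) → Fin 4 → ℝ) (chi : (Fin 4 → ZMod 2) → TorusSite 4 2 → ℝ) (Yh : (Edge 4 2 → Matrix (Fin N) (Fin N) ℂ) → (Fin 4 → ZMod 2) → Fin 4 → Matrix (Fin N) (Fin N) ℂ) (hat : Matrix (TorusSite 4 2 × Fin N × Fin 4) (TorusSite 4 2 × Fin N × Fin 4) ℂ → (Fin 4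 → ZMod 2) → (Fin 4 → ZMod 2) → Matrix (Fin N × Fin 4) (Fin N × Fin 4) ℂ), (∀ E, Dl E = Matrix.of fun (p q : TorusSite 4 2 × Fin N × Fin 4) => -(1 / 2 : ℂ) * ∑ μ : Fin 4, ((if q.1 = Site.shift p.1 μ then ((1 : Matrix (Fin 4) (Fin 4) ℂ) - euclideanGamma μ) p.2.2 q.2.2 * (((u μ : Matrix.unitaryGroup (Fin N) ℂ) : Matrix (Fin N) (Fin N) ℂ) * E (p.1, μ)) p.2.1 q.2.1 else 0) + (if p.1 = Site.shift q.1 μ then ((1 : Matrix (Fin 4) (Fin 4) ℂ) + euclideanGamma μ) p.2.2 q.2.2 * (((u μ : Matrix.unitaryGroup (Fin N) ℂ) : Matrix (Fin N) (Fin N) ℂ) * E (q.1, μ))ᴴ p.2.1 q.2.1 else 0))) → (∀ s κ, mom s κ = θ κ + Real.pi * ((s κ).val : ℝ)) → (∀ s x, chi s x = (-1 : ℝ) ^ (∑ κ : Fin 4, (s κ).val * (x κ).val)) → (∀ E s μ, Yh E s μ = ∑ x : TorusSite 4 2, ((chi s x : ℝ) : ℂ) • E (x, μ)) → (∀ A k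 k', hat A k k' = ∑ y : TorusSite 4 2, ∑ z : TorusSite 4 2, ((chi k y * chi k' z : ℝ) : ℂ) • Matrix.of (fun c c' : Fin N × Fin 4 => A (y, c) (z, c'))) → ∀ (E : Edge 4 2 → Matrix (Fin N) (Fin N) ℂ) (k k' : Fin 4 → ZMod 2), hat (Dl E) k k' = ∑ ν : Fin 4, ((-(1 / 2 : ℂ) * Complex.exp (↑(mom k' ν) * Complex.I)) • Matrix.kroneckerMap (fun a b => a * b) (Yh E (k + k') ν) ((1 : Matrix (Fin 4) (Fin 4) ℂ) - euclideanGamma ν) + (-(1 / 2 : ℂ) * Complex.exp (-(↑(mom k ν) * Complex.I))) • Matrix.kroneckerMap (fun a b => a * b) ((Yh E (k + k') ν)ᴴ) ((1 : Matrix (Fin 4) (Fin 4) ℂ) + euclideanGamma ν)) := by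
  intro N θ u hu Dl mom chi Yh hat hDl hmom hchi hYh hhat E k k'
  exact hat_hop θ u Dl mom chi Yh hat hu hDl hmom hchi hYh hhat E k k'

end Summit.QuantumFields.QCD.Cruxes.FlatCellOptimal.BlockHessian

end
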